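import Literature.MathematicalPhysics.QuantumFieldTheory.Balaban1983to89.B9Thm37Glue
import Literature.MathematicalPhysics.QuantumFieldTheory.Balaban1983to89.B9Thm37GlueCor36

/-!
# `Balaban1983to89.B9Thm37Whole` — [B9] Theorem 3.7 (p. 409) AS THE WHOLE PRINTED LEAF `B9.Thm37Printed`: a glue module
# over the landed entry theorems of the lineage `B9Thm37Glue` (entries 1–4 of (3.42) for G′ = Σ_ω …)

T. Bałaban, *Propagators for lattice gauge theories in a background field*, Commun. Math. Phys. **99** (1985) 389–434
[`Balaban1985BackgroundPropagators`, "B9"]; [4] = T. Bałaban, *Propagators and renormalization transformations for lattice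
gauge theories. II*, Commun. Math. Phys. **96** (1984) 223–250 [`Balaban1984PropagatorsII`].

statement-level skeleton of published theorems with citation tags; proofs where landed; nothing here is a claim about the
Yang–Mills mass gap

THE PRINTED LOCI (verbatim).  p. 409, Theorem 3.7: *"For M sufficiently large, and a configuration U satisfying (3.35), the
operator G′ can be represented as G′ = G′₀(I − R′)^{−1} = G′₀Σ_{n=0}^∞R′ⁿ = Σ_ω h_{□₀}G′_{□₀}h_{□₀}K(h_{□₁})G′_{□₁}h_{□₁}·…·
K(h_{□ₙ})G′_{□ₙ}h_{□ₙ}, (3.90) where ω = (□₀, □₁, ⋯, □ₙ), □ᵢ∈𝒟, □ᵢ ∩ □ᵢ₊₁ ≠ ∅. The expansion is convergent in all norms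
appearing in the inequalities (3.42)–(3.47)."*; p. 409: *"the sequence {Ω_n(□)} satisfies the assumptions of Corollary 3.6.
The operators constructed for this sequence, which we denote by G′_□(U), …, satisfy all the inequalities of Theorems 3.1–3.3
correspondingly."*; p. 410: *"This theorem follows simply from Corollary 3.6 holding for all G′_□, □ ∈ 𝒟, from the bound
(3.89) and Lemma 2.1. […] Theorem 3.7 implies that all the inequalities (3.42)–(3.47) hold for G′, thus we have completed
the proof of Theorem 3.1."*

THE POINT.  The cell's typed skeleton `…Balaban1983to89.B9` carries Theorem 3.7 as ONE convergence predicate over ABSTRACT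
expansion data: `B9.Thm37Printed c35 geo bg E` = "∃ M₂ a₀ > 0, ∀ i, M₂ ≤ M → ∀ α₀ > 0, Mα₀ ≤ a₀ → ∀ U, (3.35) →
(E i).Converges U" with `E : ∀ i, B9.RWExpansion (geo i) (bg i)` FREE data whose field `Converges` is an arbitrary predicate;
the knit `B9LeafKnit` and the DAG binding `DagBinding.B9LeafX` consume it only as the hypothesis `t37` (and through
`B9.thm31_of_thm37`, `B9.thm33_of_thm37_310`).  Meanwhile the lineage `B9Thm37Sum` → `B9Thm37Glue` (→ `…T`/`…St`/`…Sz`/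
`…TowerEntries`, torus twins) PROVES the content of the printed sentence entry by entry — `B9Thm37Glue.thm37_entry1_of_342`
(G′), `thm37_leftEntry_of_342` (∇_UG′, Δ_UG′), `thm37_rightEntry_of_342` (G′∇*_U) — as [4]-(2.51) block majorants of the SUM
(3.90) over function lattices, from Corollary 3.6 for the G′_□ and the structure of the expansion; but no theorem concludes
the leaf `B9.Thm37Printed` itself (dag-lead NODE-TABLE row n06: "0 provers").  THIS FILE is that glue:

* §1 `Ops g B X Y ι` — the operator letters of (3.87)–(3.90) at ONE family member as functions of the background U (G′(U),
  Δ′_a(U), G′_□(U), ∇_U, ∇*_U, Δ_U, K(h_□) = P_□∇_U + C_□, the Leibniz letters of ∇_U ∕ Δ_U ∕ ∇*_U through M_{h_□}, the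
  transposed letters of (3.88)) together with the partition data {h_□}, S_□, S′_□ and the coefficient kernels — a PARAMETER
  RECORD, nothing constructed; `Conv342 𝔬 R H C δ U` — «the sum (3.90) G′(U) obeys the four inequalities (3.42) with
  constants (C, δ)» in the lineage's shapes (`B6RandomWalk.HasMajorant` ∕ `B6RandomWalkHom.HasMajorantHom` over
  `B9Thm34Ext.toB6`); `E37OfOps 𝔴 𝔬 R H C δ` — the expansion data `𝔴` (walks, terms, localisation: the readings Corollary 3.8
  speaks about, UNTOUCHED) with its convergence predicate SET to `Conv342`.
* §2 the hypothesis schemas, each a `Prop`-structure of printed shape: `Sizes` (the sizes κ of the coefficient kernels; print: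
  O(M⁻¹) for ∂h_□, Δh_□, [4] (2.39)–(2.44)), `StaticOK` (geometry of d, the partition of unity and the kernels, the overlap
  counts N, N′, the comparability constant C_ℓ), `Local342` («Corollary 3.6 holding for all G′_□», p. 410 — the lineage inputs
  `h342_1 … h342_4` at U), `Identities` (G′Δ′_a = I, (3.88), (3.88)ᵀ, the three Leibniz rules and the coefficient majorants at U).
* §3 `conv342_of_local342` — ONE member, ONE U: the four entries with ONE explicit pair of constants
  C = `const37 …` = 2B₀(N + N′e^{δ₀ρ}C_ℓK)c₁(α), δ = (1 − 2α)δ₀, under the located smallness in the form «≤ ½»;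
  ★ `thm37Printed_of_local342` — **THE WHOLE PRINTED LEAF** `B9.Thm37Printed c35 geo bg (fun i => E37OfOps …)` from:
  Corollary 3.6 for the G′_□(U) under the printed provisos (M ≥ M₁, O(1)Mα₀ ≤ a₁, (3.35)), [4] Lemma 2.1 (2.61) for M ≥ M_L,
  the kernel sizes ≤ θ₀M⁻¹ («for M sufficiently large»: M₂ := max(M₁, M_L, 2N′B₀e^{δ₀ρ}θ₀c₁(α)), a₀ := a₁∕O(1)), and the
  schemas of §2.
* §4 `clause342_of_thm37Printed` — the consumer face: with the co-readings `B9Thm37GlueCor36.CoRealizes` of the four model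
  operators by the observation quantities of a kernel family `Gp i`, the leaf AT `E37OfOps` yields the four (3.42) clauses
  `B9Thm37GlueCor36.Clause342 (Gp i) n C δ U` under the same provisos — the (3.42) block of `B9.RWSumsYieldIneqs` ∕
  `B9.Thm31Printed` (p. 410: *"Theorem 3.7 implies that all the inequalities (3.42)–(3.47) hold for G′"*), so the chosen
  `Converges` is not junk-closable.

HONEST SCOPE.  Nothing of print is asserted: Corollary 3.6 for the G′_□, (3.88)∕(3.88)ᵀ, G′Δ′_a = I, the Leibniz rules, the
kernel sizes (NOT displayed in print, cell GAPS G-pv21g4-1 (i)), the counts N, N′ (G-B9-22), [4] Lemma 2.1 (2.61) and the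
geometry of the multiscale distance are HYPOTHESES of printed shape, exactly as in the lineage; `Conv342` covers the sup block
(3.42) only — the Hölder ∕ L² ∕ weighted members (3.43)–(3.47) of «all norms» are the `B9Thm37AllNorms*` lineage and are not
conjoined here; the rate comes out as (1 − 2α)δ₀ (print keeps δ₀ by shrinking it tacitly, [4] p. 234).  Value: kernel-checked
bookkeeping — the printed leaf inhabited over the lineage's objects — NOT a node discharge, NOT summit progress; nothing
continuum, nothing about the mass gap.  Cell `pub-ymgap` (HUMAN RULING D-0062), Track A node N06 [B9], seat
`pub-ymgap-dag-n06-c` (director-ym R134 row s1), 2026-08-26.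
-/

namespace Literature.MathematicalPhysics.QuantumFieldTheory.Balaban1983to89.B9Thm37Whole

open Literature.MathematicalPhysics.QuantumFieldTheory.Balaban1983to89
open Finset B6RandomWalk B6RandomWalkHom B9Thm37Sum B9Thm34Ext B9Thm37Glue B9Thm37GlueCor36

noncomputable section

/-! ## §1 The operator letters of (3.87)–(3.90) at one member; the convergence content; the expansion data -/

section OneMember

variable {g : B9.Geometry} [Fintype g.Site] [DecidableEq g.Site] {B : B9.Backgrounds} {X Y ι : Type}

/-- **THE LETTERS OF THE EXPANSION (3.90) AT ONE FAMILY MEMBER**, as total functions of the background configuration U, over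
a lattice of fine sites `X`, a lattice of bonds `Y` (block maps `blk`, `blkY` into 𝔅) and the cube index `ι` = 𝒟 (p. 408):
`Gp U` = G′(U); `Δa U` = Δ′_a(U); `Gsq U □` = G′_□(U) (p. 409); `D U` = ∇_U, `Dstar U` = ∇*_U, `Lap U` = Δ_U ((3.3), (3.8),
(3.23)); `P U □`, `Cop U □` = the letters of K(h_□) = P_□∇_U + C_□ ((3.88), [4] (2.39)–(2.40)); `PD`, `CD` ∕ `PL`, `CL` = the
letters of the Leibniz rules of ∇_U ∕ Δ_U through M_{h_□} (first line of (3.88)); `Pt`, `Ct`, `CLt` = the letters of the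
transposed (3.88) and of the right Leibniz rule of ∇*_U (`B9Thm37Glue` v4); `h`, `hY` = the partition of unity {h_□} read on
sites ∕ bonds (p. 408: Σ_□h²_□ = 1); `S □`, `S' □` = the blocks met by supp h_□ ∕ by the coefficients of K(h_□); `KP … KCLt` =
the nonnegative coefficient kernels (row type for P, C, PD, CD, PL, CL; column type for Pt, Ct, CLt).  A PARAMETER RECORD —
nothing is constructed or asserted (pattern of `B9PinCarriersKLevelV1.OperatorLayerY`, `B9SupplySockB9P3ZdLetters.OpsZd`).
[cite: Balaban1985BackgroundPropagators, (3.87)–(3.90) pp.408–409; Balaban1984PropagatorsII, (2.39)–(2.40) pp.229–230] -/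
structure Ops (g : B9.Geometry) (B : B9.Backgrounds) (X Y ι : Type) where
  blk : X → g.Site
  blkY : Y → g.Site
  S : ι → Finset g.Site
  S' : ι → Finset g.Site
  h : ι → X → ℝ
  hY : ι → Y → ℝ
  KP : ι → g.Site → g.Site → ℝ
  KC : ι → g.Site → g.Site → ℝ
  KPD : ι → g.Site → g.Site → ℝ
  KCD : ι → g.Site → g.Site → ℝ
  KPL : ι → g.Site → g.Site → ℝ
  KCL : ι → g.Site → g.Site → ℝ
  KPt : ι → g.Site → g.Site → ℝ
  KCt : ι → g.Site → g.Site → ℝ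
  KCLt : ι → g.Site → g.Site → ℝ
  Gp : B.Cfg → Module.End ℝ (X → ℝ)
  Δa : B.Cfg → Module.End ℝ (X → ℝ)
  Gsq : B.Cfg → ι → Module.End ℝ (X → ℝ)
  D : B.Cfg → (X → ℝ) →ₗ[ℝ] (Y → ℝ)
  Dstar : B.Cfg → (Y → ℝ) →ₗ[ℝ] (X → ℝ)
  Lap : B.Cfg → Module.End ℝ (X → ℝ)
  P : B.Cfg → ι → (Y → ℝ) →ₗ[ℝ] (X → ℝ)
  Cop : B.Cfg → ι → Module.End ℝ (X → ℝ)
  PD : B.Cfg → ι → (Y → ℝ) →ₗ[ℝ] (Y → ℝ)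
  CD : B.Cfg → ι → (X → ℝ) →ₗ[ℝ] (Y → ℝ)
  PL : B.Cfg → ι → (Y → ℝ) →ₗ[ℝ] (X → ℝ)
  CL : B.Cfg → ι → Module.End ℝ (X → ℝ)
  Pt : B.Cfg → ι → (X → ℝ) →ₗ[ℝ] (Y → ℝ)
  Ct : B.Cfg → ι → Module.End ℝ (X → ℝ)
  CLt : B.Cfg → ι → (Y → ℝ) →ₗ[ℝ] (X → ℝ)

/-- **«The expansion is convergent in all norms appearing in the inequalities (3.42)»** (Theorem 3.7, p. 409) READ ON THE SUM:
the operator G′(U) (= the sum of (3.90), `𝔬.Gp U`) obeys the four inequalities (3.42) (p. 397: *"|(G′(U)λ)(x)|,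
|(∇_UG′(U)λ)(x)|, |(G′(U)∇*_Uλ)(x)|, |(Δ_UG′(U)λ)(x)| ≦ B₀[(L^jη)², L^jη, L^jη, 1]e^{−δ₀d(y,y′)}|λ| for x ∈ Δ(y), y ∈ Λ_j,
supp λ ⊂ Δ(y′)"*) with constants (C, δ), in the [4]-(2.51) majorant shapes the lineage `B9Thm37Glue` concludes
(`thm37_entry1_of_342`, `thm37_leftEntry_of_342` at E = ∇_U and E = Δ_U, `thm37_rightEntry_of_342`) over the transported
geometry `B9Thm34Ext.toB6 g R H`.  The Hölder ∕ L² ∕ weighted members (3.43)–(3.47) are NOT part of this predicate.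
[cite: Balaban1985BackgroundPropagators, Thm 3.7 p.409 + (3.42) p.397; Balaban1984PropagatorsII, (2.51) p.232] -/
def Conv342 (𝔬 : Ops g B X Y ι) (R : ℝ) (H : Prop) (C δ : ℝ) (U : B.Cfg) : Prop :=
  HasMajorant (g := toB6 g R H) 𝔬.blk (𝔬.Gp U)
      (fun (a b : g.Site) => C * g.len a ^ 2 * Real.exp (-(δ * g.dist a b))) ∧
    HasMajorantHom (g := toB6 g R H) 𝔬.blk 𝔬.blkY (𝔬.D U ∘ₗ 𝔬.Gp U)
      (fun (a b : g.Site) => C * g.len a * Real.exp (-(δ * g.dist a b))) ∧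
    HasMajorantHom (g := toB6 g R H) 𝔬.blkY 𝔬.blk (𝔬.Gp U ∘ₗ 𝔬.Dstar U)
      (fun (a b : g.Site) => C * g.len a * Real.exp (-(δ * g.dist a b))) ∧
    HasMajorantHom (g := toB6 g R H) 𝔬.blk 𝔬.blk (𝔬.Lap U ∘ₗ 𝔬.Gp U)
      (fun (a b : g.Site) => C * Real.exp (-(δ * g.dist a b)))

/-- **The expansion data of Theorem 3.7 ∕ Corollary 3.8 with its convergence predicate PINNED**: the carrier `𝔴` (walks ω,
|ω|, end-points, the distance d(ω, y, y′) of (3.93), the terms and their U-localisation — the readings Corollary 3.8 (3.94)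
speaks about, kept as given) with `Converges U := Conv342 𝔬 R H C δ U`.  This is the `E` at which the leaf
`B9.Thm37Printed` is inhabited below (`thm37Printed_of_local342`).
[cite: Balaban1985BackgroundPropagators, Thm 3.7 (3.90) p.409 + Cor. 3.8 (3.93)–(3.94) p.410] -/
def E37OfOps (𝔴 : B9.RWExpansion g B) (𝔬 : Ops g B X Y ι) (R : ℝ) (H : Prop) (C δ : ℝ) : B9.RWExpansion g B :=
  { 𝔴 with Converges := fun U => Conv342 𝔬 R H C δ U }

omit [DecidableEq g.Site] in
/-- The convergence predicate of `E37OfOps` IS `Conv342` (by `Iff.rfl`): the typed reading of *"The expansion is convergent in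
all norms appearing in the inequalities (3.42)"*. [cite: Balaban1985BackgroundPropagators, Thm 3.7 p.409] -/
theorem converges_E37OfOps (𝔴 : B9.RWExpansion g B) (𝔬 : Ops g B X Y ι) (R : ℝ) (H : Prop) (C δ : ℝ) (U : B.Cfg) :
    (E37OfOps 𝔴 𝔬 R H C δ).Converges U ↔ Conv342 𝔬 R H C δ U :=
  Iff.rfl

omit [DecidableEq g.Site] in
/-- `E37OfOps` leaves the walk terms of Corollary 3.8 — the left-hand sides of (3.94) — untouched (by `rfl`).
[cite: Balaban1985BackgroundPropagators, Cor. 3.8 (3.94) p.410] -/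
theorem E37OfOps_term (𝔴 : B9.RWExpansion g B) (𝔬 : Ops g B X Y ι) (R : ℝ) (H : Prop) (C δ : ℝ) :
    (E37OfOps 𝔴 𝔬 R H C δ).term = 𝔴.term :=
  rfl

omit [DecidableEq g.Site] in
/-- `E37OfOps` leaves the U-localisation clause of Corollary 3.8 (*"depends on U restricted to □̃⁵₀ ∪ … ∪ □̃⁵ₙ"*)
untouched (by `rfl`). [cite: Balaban1985BackgroundPropagators, Cor. 3.8 p.410] -/
theorem E37OfOps_locDep (𝔴 : B9.RWExpansion g B) (𝔬 : Ops g B X Y ι) (R : ℝ) (H : Prop) (C δ : ℝ) :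
    (E37OfOps 𝔴 𝔬 R H C δ).LocDep = 𝔴.LocDep :=
  rfl

/-! ## §2 The hypothesis schemas (printed shape; nothing asserted) -/

/-- **The SIZES of the coefficient kernels** entering the expansion at one member: `kP`, `kC` = the row sums of the kernels of
P_□, C_□ in K(h_□) = P_□∇_U + C_□ against L^{j″}η, (L^{j″}η)² (the θ = O(M⁻¹) of (3.89), [4] (2.44)); `kPD`, `kCD` ∕ `kPL`,
`kCL` = those of the Leibniz letters of ∇_U (weight L^jη) ∕ Δ_U (weight 1) through M_{h_□}; `kPt`, `kCt` = the column sums of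
the transposed letters of (3.88); `kCLt` = that of the right Leibniz letter of ∇*_U.  Print: ∂h_□ = O((ML^jη)⁻¹),
Δh_□ = O((ML^jη)⁻²) for the partition of unity of [4] Sect. A ((1.118) [`Balaban1984PropagatorsI`] ∕ (2.36)–(2.40)) — the
sizes are NOT displayed in print (cell GAPS G-pv21g4-1 (i)); here they are free letters.
[cite: Balaban1985BackgroundPropagators, (3.88)–(3.89) p.409; Balaban1984PropagatorsII, (2.39)–(2.44) pp.229–230] -/
structure Sizes where
  kP : ℝ
  kC : ℝ
  kPD : ℝ
  kCD : ℝ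
  kPL : ℝ
  kCL : ℝ
  kPt : ℝ
  kCt : ℝ
  kCLt : ℝ

/-- All nine sizes are nonnegative (they bound row ∕ column sums of the nonnegative coefficient kernels |∂h_□|, |Δh_□|, … of
[4] (2.39)–(2.44)). [cite: Balaban1984PropagatorsII, (2.39)–(2.44) pp.229–230] -/
structure Sizes.Nonneg (κ : Sizes) : Prop where
  kP : 0 ≤ κ.kP
  kC : 0 ≤ κ.kC
  kPD : 0 ≤ κ.kPD
  kCD : 0 ≤ κ.kCD
  kPL : 0 ≤ κ.kPL
  kCL : 0 ≤ κ.kCL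
  kPt : 0 ≤ κ.kPt
  kCt : 0 ≤ κ.kCt
  kCLt : 0 ≤ κ.kCLt

/-- **«For M sufficiently large»** (Theorem 3.7) as conditions on the sizes at a member with cube parameter M: the K(h_□)
sizes (row: `kP + kC`; column: `kPt + C_ℓ·kCt`) are ≦ θ₀M⁻¹ — the displayed O(M⁻¹) of (3.89) ∕ [4] (2.44) — and the
Leibniz sizes are ≦ K (they enter the constant, not the smallness). [cite: Balaban1985BackgroundPropagators, (3.89) p.409; Balaban1984PropagatorsII, (2.44) p.230] -/
structure Sizes.Bounded (κ : Sizes) (K θ₀ Cℓ M : ℝ) : Prop where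
  nonneg : κ.Nonneg
  leibD : κ.kPD + κ.kCD ≤ K
  leibL : κ.kPL + κ.kCL ≤ K
  leibT : κ.kCLt ≤ K
  row : κ.kP + κ.kC ≤ θ₀ * M⁻¹
  col : κ.kPt + Cℓ * κ.kCt ≤ θ₀ * M⁻¹

/-- **THE STATIC DATA AT ONE MEMBER** (independent of U): the multiscale distance d of [4] (2.46) is a pseudo-metric
((2.54) triangle inequality, d(y, y) = 0, symmetry, d ≧ 0) and L^jη > 0; the partition of unity has |h_□| ≦ 1 with
supp h_□ within the blocks of S_□ (on sites and on bonds); every block meets at most N of the S_□ and N′ of the S′_□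
(p. 409: the cubes □̃ overlap finitely often; cell GAPS G-B9-22); the scales on S_□ × S′_□ are comparable, L^jη ≦ C_ℓL^{j′}η
(both are cubes of 𝒟_j met by one □); and each of the nine coefficient kernels is ≧ 0, of range ≦ ρ, with the row
(resp. column) sums of `Sizes`.  Hypotheses of the lineage theorems, bundled; nothing asserted.
[cite: Balaban1985BackgroundPropagators, (3.87)–(3.89) pp.408–409; Balaban1984PropagatorsII, (2.46) p.231, (2.54) p.233, (2.39)–(2.44) pp.229–230] -/
structure StaticOK [Fintype ι] (𝔬 : Ops g B X Y ι) (ρ N N' Cℓ : ℝ) (κ : Sizes) : Prop where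
  tri : ∀ a b c : g.Site, g.dist a c ≤ g.dist a b + g.dist b c
  refl : ∀ y : g.Site, g.dist y y = 0
  symm : ∀ y y' : g.Site, g.dist y y' = g.dist y' y
  dnn : ∀ y y' : g.Site, 0 ≤ g.dist y y'
  lenpos : ∀ y : g.Site, 0 < g.len y
  hh : ∀ i x, |𝔬.h i x| ≤ 1
  hS : ∀ i x, 𝔬.h i x ≠ 0 → 𝔬.blk x ∈ 𝔬.S i
  hhY : ∀ i v, |𝔬.hY i v| ≤ 1
  hSY : ∀ i v, 𝔬.hY i v ≠ 0 → 𝔬.blkY v ∈ 𝔬.S i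
  cnt : ∀ a : g.Site, (∑ i, if a ∈ 𝔬.S i then (1 : ℝ) else 0) ≤ N
  cnt' : ∀ a : g.Site, (∑ i, if a ∈ 𝔬.S' i then (1 : ℝ) else 0) ≤ N'
  comp : ∀ i (a b : g.Site), a ∈ 𝔬.S i → b ∈ 𝔬.S' i → g.len a ≤ Cℓ * g.len b
  KP_nonneg : ∀ i a b, 0 ≤ 𝔬.KP i a b
  KP_loc : ∀ i a y'', 𝔬.KP i a y'' ≠ 0 → g.dist a y'' ≤ ρ
  KP_row : ∀ i (a : g.Site), ∑ y'' : g.Site, 𝔬.KP i a y'' * g.len y'' ≤ if a ∈ 𝔬.S' i then κ.kP else 0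
  KC_nonneg : ∀ i a b, 0 ≤ 𝔬.KC i a b
  KC_loc : ∀ i a y'', 𝔬.KC i a y'' ≠ 0 → g.dist a y'' ≤ ρ
  KC_row : ∀ i (a : g.Site), ∑ y'' : g.Site, 𝔬.KC i a y'' * g.len y'' ^ 2 ≤ if a ∈ 𝔬.S' i then κ.kC else 0
  KPD_nonneg : ∀ i a b, 0 ≤ 𝔬.KPD i a b
  KPD_loc : ∀ i a y'', 𝔬.KPD i a y'' ≠ 0 → g.dist a y'' ≤ ρ
  KPD_row : ∀ i (a : g.Site), ∑ y'' : g.Site, 𝔬.KPD i a y'' * g.len y'' ≤ if a ∈ 𝔬.S' i then κ.kPD * g.len a else 0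
  KCD_nonneg : ∀ i a b, 0 ≤ 𝔬.KCD i a b
  KCD_loc : ∀ i a y'', 𝔬.KCD i a y'' ≠ 0 → g.dist a y'' ≤ ρ
  KCD_row : ∀ i (a : g.Site),
    ∑ y'' : g.Site, 𝔬.KCD i a y'' * g.len y'' ^ 2 ≤ if a ∈ 𝔬.S' i then κ.kCD * g.len a else 0
  KPL_nonneg : ∀ i a b, 0 ≤ 𝔬.KPL i a b
  KPL_loc : ∀ i a y'', 𝔬.KPL i a y'' ≠ 0 → g.dist a y'' ≤ ρ
  KPL_row : ∀ i (a : g.Site), ∑ y'' : g.Site, 𝔬.KPL i a y'' * g.len y'' ≤ if a ∈ 𝔬.S' i then κ.kPL else 0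
  KCL_nonneg : ∀ i a b, 0 ≤ 𝔬.KCL i a b
  KCL_loc : ∀ i a y'', 𝔬.KCL i a y'' ≠ 0 → g.dist a y'' ≤ ρ
  KCL_row : ∀ i (a : g.Site), ∑ y'' : g.Site, 𝔬.KCL i a y'' * g.len y'' ^ 2 ≤ if a ∈ 𝔬.S' i then κ.kCL else 0
  KPt_nonneg : ∀ i a b, 0 ≤ 𝔬.KPt i a b
  KPt_loc : ∀ i y'' b, 𝔬.KPt i y'' b ≠ 0 → g.dist y'' b ≤ ρ
  KPt_col : ∀ i (b : g.Site), (∑ y'' : g.Site, 𝔬.KPt i y'' b) * g.len b ≤ if b ∈ 𝔬.S' i then κ.kPt else 0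
  KCt_nonneg : ∀ i a b, 0 ≤ 𝔬.KCt i a b
  KCt_loc : ∀ i y'' b, 𝔬.KCt i y'' b ≠ 0 → g.dist y'' b ≤ ρ
  KCt_col : ∀ i (b : g.Site), (∑ y'' : g.Site, 𝔬.KCt i y'' b) * g.len b ^ 2 ≤ if b ∈ 𝔬.S' i then κ.kCt else 0
  KCLt_nonneg : ∀ i a b, 0 ≤ 𝔬.KCLt i a b
  KCLt_loc : ∀ i y'' b, 𝔬.KCLt i y'' b ≠ 0 → g.dist y'' b ≤ ρ
  KCLt_col : ∀ i (b : g.Site), (∑ y'' : g.Site, 𝔬.KCLt i y'' b) * g.len b ≤ if b ∈ 𝔬.S' i then κ.kCLt else 0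

/-- **«COROLLARY 3.6 HOLDING FOR ALL G′_□, □ ∈ 𝒟»** (p. 410; p. 409: *"The operators constructed for this sequence, which we
denote by G′_□(U), … satisfy all the inequalities of Theorems 3.1–3.3"*) at the configuration U, in the lineage's shapes —
entries 1, 2, 3, 4 of (3.42) for every G′_□(U) with one pair (B₀, δ₀): exactly the inputs `h342_1`, `h342_2`, `h342_3`,
`h342_4` of `B9Thm37Glue`.  (From the cell's typed `B9.Cor36Printed` they follow by `B9Thm37GlueCor36.h342_of_cor36_joint`
under a `Realizes` reading.)  A HYPOTHESIS SCHEMA; Corollary 3.6 is not asserted.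
[cite: Balaban1985BackgroundPropagators, Cor. 3.6 p.408 + p.409 + (3.42) p.397] -/
structure Local342 (𝔬 : Ops g B X Y ι) (R : ℝ) (H : Prop) (B₀ δ₀ : ℝ) (U : B.Cfg) : Prop where
  e0 : ∀ i, HasMajorant (g := toB6 g R H) 𝔬.blk (𝔬.Gsq U i)
    (fun (a b : g.Site) => B₀ * g.len a ^ 2 * Real.exp (-(δ₀ * g.dist a b)))
  e1 : ∀ i, HasMajorantHom (g := toB6 g R H) 𝔬.blk 𝔬.blkY (𝔬.D U ∘ₗ 𝔬.Gsq U i)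
    (fun (a b : g.Site) => B₀ * g.len a * Real.exp (-(δ₀ * g.dist a b)))
  e2 : ∀ i, HasMajorantHom (g := toB6 g R H) 𝔬.blkY 𝔬.blk (𝔬.Gsq U i ∘ₗ 𝔬.Dstar U)
    (fun (a b : g.Site) => B₀ * g.len a * Real.exp (-(δ₀ * g.dist a b)))
  e3 : ∀ i, HasMajorantHom (g := toB6 g R H) 𝔬.blk 𝔬.blk (𝔬.Lap U ∘ₗ 𝔬.Gsq U i)
    (fun (a b : g.Site) => B₀ * Real.exp (-(δ₀ * g.dist a b)))

/-- **THE ALGEBRAIC STRUCTURE OF THE EXPANSION AT U** (hypotheses of the lineage, bundled): the coefficient letters are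
majorised by their kernels (`hP … hCLt`); the Leibniz rules of ∇_U, Δ_U through M_{h_□} (first display line of (3.88),
[4] (2.39)–(2.40)) and the right Leibniz rule of ∇*_U (`B9Thm37Glue.mulOp_comp_covDT` in the lattice model); G′Δ′_a = I
(G′ = the inverse of Δ′_a restricted as in (3.27)); (3.88) *"hence Δ′_aG′₀ = I − Σ_□K(h_□)G′_□h_□ = I − R′"* and its
transpose G′₀Δ′_a = I − Σ_□h_□G′_□(∇*_UPᵗ_□ + Cᵗ_□) (`B9Thm37Glue` v4 `h388T`; derived from (3.88) in v6 for transpose pairs).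
Nothing asserted. [cite: Balaban1985BackgroundPropagators, (3.87)–(3.88) pp.408–409 + (3.27) p.395; Balaban1984PropagatorsII, (2.39)–(2.40) pp.229–230] -/
structure Identities [Fintype ι] (𝔬 : Ops g B X Y ι) (R : ℝ) (H : Prop) (U : B.Cfg) : Prop where
  hP : ∀ i, HasMajorantHom (g := toB6 g R H) 𝔬.blkY 𝔬.blk (𝔬.P U i) (𝔬.KP i)
  hC : ∀ i, HasMajorant (g := toB6 g R H) 𝔬.blk (𝔬.Cop U i) (𝔬.KC i)
  hPD : ∀ i, HasMajorantHom (g := toB6 g R H) 𝔬.blkY 𝔬.blkY (𝔬.PD U i) (𝔬.KPD i)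
  hCD : ∀ i, HasMajorantHom (g := toB6 g R H) 𝔬.blk 𝔬.blkY (𝔬.CD U i) (𝔬.KCD i)
  hPL : ∀ i, HasMajorantHom (g := toB6 g R H) 𝔬.blkY 𝔬.blk (𝔬.PL U i) (𝔬.KPL i)
  hCL : ∀ i, HasMajorantHom (g := toB6 g R H) 𝔬.blk 𝔬.blk (𝔬.CL U i) (𝔬.KCL i)
  hPt : ∀ i, HasMajorantHom (g := toB6 g R H) 𝔬.blk 𝔬.blkY (𝔬.Pt U i) (𝔬.KPt i)
  hCt : ∀ i, HasMajorant (g := toB6 g R H) 𝔬.blk (𝔬.Ct U i) (𝔬.KCt i)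
  hCLt : ∀ i, HasMajorantHom (g := toB6 g R H) 𝔬.blkY 𝔬.blk (𝔬.CLt U i) (𝔬.KCLt i)
  leibD : ∀ i, 𝔬.D U ∘ₗ mulOp (𝔬.h i) = mulOp (𝔬.hY i) ∘ₗ 𝔬.D U + (𝔬.PD U i ∘ₗ 𝔬.D U + 𝔬.CD U i)
  leibL : ∀ i, 𝔬.Lap U ∘ₗ mulOp (𝔬.h i) = mulOp (𝔬.h i) ∘ₗ 𝔬.Lap U + (𝔬.PL U i ∘ₗ 𝔬.D U + 𝔬.CL U i)
  leibT : ∀ i, mulOp (𝔬.h i) ∘ₗ 𝔬.Dstar U = 𝔬.Dstar U ∘ₗ mulOp (𝔬.hY i) + 𝔬.CLt U i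
  inv : 𝔬.Gp U * 𝔬.Δa U = 1
  eq388 : 𝔬.Δa U * (∑ i, mulOp (𝔬.h i) * 𝔬.Gsq U i * mulOp (𝔬.h i)) =
    1 - ∑ i, (𝔬.P U i ∘ₗ 𝔬.D U + 𝔬.Cop U i) * 𝔬.Gsq U i * mulOp (𝔬.h i)
  eq388T : (∑ i, mulOp (𝔬.h i) * 𝔬.Gsq U i * mulOp (𝔬.h i)) * 𝔬.Δa U =
    1 - ∑ i, mulOp (𝔬.h i) * 𝔬.Gsq U i * (𝔬.Dstar U ∘ₗ 𝔬.Pt U i + 𝔬.Ct U i)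

/-! ## §3 Theorem 3.7 at one member and one U; the whole printed leaf -/

/-- **The constant of the inhabited leaf**: C = 2B₀(N + N′e^{δ₀ρ}C_ℓK)c₁(α) — twice (for «M sufficiently large», the factor
(1 − N′θc₁(α))⁻¹ ≦ 2 of the Neumann series) the largest of the four entry constants of the lineage, c₁(α) = `B6.c1 d δ₀ α` the
constant of [4] Lemma 2.1 (2.61). [cite: Balaban1985BackgroundPropagators, Thm 3.7 pp.409–410; Balaban1984PropagatorsII, Lemma 2.1 (2.61) p.234] -/
def const37 (d : ℕ) (δ₀ α ρ B₀ N N' Cℓ K : ℝ) : ℝ :=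
  2 * B₀ * (N + N' * Real.exp (δ₀ * ρ) * Cℓ * K) * B6.c1 d δ₀ α

omit [Fintype g.Site] [DecidableEq g.Site] in
/-- Arithmetic of «M sufficiently large»: a constant A(1 − q)⁻¹ with q ≦ ½ and A ≦ A′ is ≦ 2A′, against nonnegative weights
and a larger exponential factor. [folklore] -/
private theorem weaken {A A' q w e e' : ℝ} (hA : 0 ≤ A) (hAA' : A ≤ A') (hq : q ≤ 1 / 2) (hw : 0 ≤ w) (he : 0 ≤ e)
    (hee' : e ≤ e') : A * (1 - q)⁻¹ * w * e ≤ 2 * A' * w * e' := by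
  have hinv : (1 - q)⁻¹ ≤ 2 := by
    rw [inv_le_comm₀ (by linarith) (by norm_num : (0 : ℝ) < 2)]
    linarith
  have h1 : A * (1 - q)⁻¹ ≤ 2 * A' :=
    calc A * (1 - q)⁻¹ ≤ A * 2 := mul_le_mul_of_nonneg_left hinv hA
      _ ≤ A' * 2 := mul_le_mul_of_nonneg_right hAA' (by norm_num)
      _ = 2 * A' := by ring
  have hA' : 0 ≤ 2 * A' := by linarith
  calc A * (1 - q)⁻¹ * w * e = (A * (1 - q)⁻¹) * (w * e) := by ring
    _ ≤ (2 * A') * (w * e') :=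
        mul_le_mul h1 (mul_le_mul_of_nonneg_left hee' hw) (mul_nonneg hw he) hA'
    _ = 2 * A' * w * e' := by ring

omit [Fintype g.Site] [DecidableEq g.Site] in
/-- Monotonicity of the entry constants B₀(N + N′e^{δ₀ρ}s)c₁ in the size letter s. [folklore] -/
private theorem constA_le {B₀ N N' ex s t c : ℝ} (hB₀ : 0 ≤ B₀) (hN'e : 0 ≤ N' * ex) (hc : 0 ≤ c) (hst : s ≤ t) :
    B₀ * (N + N' * ex * s) * c ≤ B₀ * (N + N' * ex * t) * c := by
  have h1 : N' * ex * s ≤ N' * ex * t := mul_le_mul_of_nonneg_left hst hN'e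
  have h2 : N + N' * ex * s ≤ N + N' * ex * t := by linarith
  exact mul_le_mul_of_nonneg_right (mul_le_mul_of_nonneg_left h2 hB₀) hc

/-- **THEOREM 3.7 AT ONE MEMBER AND ONE CONFIGURATION U — the four entries of (3.42) for the sum G′(U) with ONE pair of
constants** (C = `const37 …`, δ = (1 − 2α)δ₀), glued from the lineage: entry 1 by `B9Thm37Glue.thm37_entry1_of_342`, entry 2
by `thm37_leftEntry_of_342` at E = ∇_U (W = L^jη), entry 3 by `thm37_rightEntry_of_342`, entry 4 by `thm37_leftEntry_of_342` at
E = Δ_U (W ≡ 1); inputs: Corollary 3.6 for all G′_□(U) (`Local342`), the structure of the expansion (`Identities`), the static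
data (`StaticOK`), [4] Lemma 2.1 (2.61) at the exponent α ((2.63) follows by `B6RandomWalk.ineq263_of_261`), and «M
sufficiently large» LOCATED as N′B₀e^{δ₀ρ}(k_P + k_C)c₁(α) ≦ ½, N′B₀e^{δ₀ρ}(k_{Pᵗ} + C_ℓk_{Cᵗ})c₁(α) ≦ ½ with the Leibniz
sizes ≦ K (C_ℓ ≧ 1, 0 ≦ α ≦ ½).  p. 410: *"This theorem follows simply from Corollary 3.6 holding for all G′_□, □ ∈ 𝒟, from the
bound (3.89) and Lemma 2.1."* [cite: Balaban1985BackgroundPropagators, Thm 3.7 (3.87)–(3.90) pp.408–410 + (3.42) p.397; Balaban1984PropagatorsII, Prop 2.2 (2.64)–(2.67) p.234] -/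
theorem conv342_of_local342 [Fintype X] [DecidableEq X] [Fintype Y] [DecidableEq Y] [Fintype ι]
    (𝔬 : Ops g B X Y ι) (R : ℝ) (H : Prop) (d : ℕ) (δ₀ α ρ B₀ N N' Cℓ K : ℝ) (κ : Sizes) (U : B.Cfg)
    (hB₀ : 0 ≤ B₀) (hδ₀ : 0 ≤ δ₀) (hα : 0 ≤ α) (hα2 : α ≤ 1 / 2) (hN : 0 ≤ N) (hN' : 0 ≤ N') (hCℓ : 1 ≤ Cℓ)
    (hK : 0 ≤ K) (hs : StaticOK 𝔬 ρ N N' Cℓ κ) (hκ : κ.Nonneg) (hKD : κ.kPD + κ.kCD ≤ K)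
    (hKL : κ.kPL + κ.kCL ≤ K) (hKT : κ.kCLt ≤ K) (h261 : Ineq261 d (toB6 g R H) δ₀ α)
    (hq : N' * (B₀ * Real.exp (δ₀ * ρ) * (κ.kP + κ.kC)) * B6.c1 d δ₀ α ≤ 1 / 2)
    (hq' : N' * (B₀ * Real.exp (δ₀ * ρ) * (κ.kPt + Cℓ * κ.kCt)) * B6.c1 d δ₀ α ≤ 1 / 2)
    (hl : Local342 𝔬 R H B₀ δ₀ U) (hi : Identities 𝔬 R H U) :
    Conv342 𝔬 R H (const37 d δ₀ α ρ B₀ N N' Cℓ K) ((1 - 2 * α) * δ₀) U := by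
  have hlen : ∀ y : g.Site, 0 ≤ g.len y := fun y => (hs.lenpos y).le
  have hαδ : 0 ≤ (1 - α) * δ₀ := mul_nonneg (by linarith) hδ₀
  have hαδ' : 0 ≤ α * δ₀ := mul_nonneg hα hδ₀
  have hαδ2 : 0 ≤ (1 - 2 * α) * δ₀ := mul_nonneg (by linarith) hδ₀
  have htri : Triangle254 (toB6 g R H) := fun a b c => hs.tri a b c
  have h263 : Ineq263 d (toB6 g R H) δ₀ α := ineq263_of_261 d (toB6 g R H) δ₀ α htri hδ₀ (by linarith) h261
  have hk12 : 0 ≤ κ.kP + κ.kC := add_nonneg hκ.kP hκ.kC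
  have hkD : 0 ≤ κ.kPD + κ.kCD := add_nonneg hκ.kPD hκ.kCD
  have hkL : 0 ≤ κ.kPL + κ.kCL := add_nonneg hκ.kPL hκ.kCL
  have hCℓ0 : 0 ≤ Cℓ := le_trans zero_le_one hCℓ
  have hsmall : N' * (B₀ * Real.exp (δ₀ * ρ) * (κ.kP + κ.kC)) * B6.c1 d δ₀ α < 1 := by linarith
  have hsmall' : N' * (B₀ * Real.exp (δ₀ * ρ) * (κ.kPt + Cℓ * κ.kCt)) * B6.c1 d δ₀ α < 1 := by linarith
  have hc1 : 0 ≤ B6.c1 d δ₀ α := c1_nonneg d δ₀ α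
  have hN'e : 0 ≤ N' * Real.exp (δ₀ * ρ) := mul_nonneg hN' (Real.exp_nonneg _)
  have hKCℓ : K ≤ Cℓ * K := by
    calc K = 1 * K := (one_mul K).symm
      _ ≤ Cℓ * K := mul_le_mul_of_nonneg_right hCℓ hK
  -- the common target constant A′ and the comparison of the exponential rates
  have hexp : ∀ a b : g.Site, Real.exp (-((1 - α) * δ₀ * g.dist a b)) ≤ Real.exp (-((1 - 2 * α) * δ₀ * g.dist a b)) := by
    intro a b
    have h0 : 0 ≤ α * δ₀ * g.dist a b := mul_nonneg hαδ' (hs.dnn a b)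
    exact Real.exp_le_exp.mpr (by nlinarith [h0])
  have hfin : ∀ w e' : ℝ, 2 * (B₀ * (N + N' * Real.exp (δ₀ * ρ) * (Cℓ * K)) * B6.c1 d δ₀ α) * w * e' =
      const37 d δ₀ α ρ B₀ N N' Cℓ K * w * e' := by
    intro w e'
    simp only [const37]
    ring
  -- entry 1: G′ (`thm37_entry1_of_342`)
  have e1 := thm37_entry1_of_342 (R := R) (H := H) 𝔬.blk 𝔬.blkY d δ₀ α ρ B₀ κ.kP κ.kC N N' 𝔬.S 𝔬.S' 𝔬.h 𝔬.KP 𝔬.KC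
    hB₀ hδ₀ hk12 hN hN' hαδ htri hs.refl hs.dnn hlen h261 h263 hsmall hs.hh hs.hS hs.cnt hs.cnt'
    hs.KP_nonneg hs.KP_loc hs.KP_row hs.KC_nonneg hs.KC_loc hs.KC_row hl.e0 hl.e1 hi.hP hi.hC hi.inv hi.eq388
  -- entry 2: ∇_UG′ (`thm37_leftEntry_of_342` at E = ∇_U, W = L^jη)
  have e2 := thm37_leftEntry_of_342 (R := R) (H := H) 𝔬.blk 𝔬.blkY 𝔬.blkY d δ₀ α ρ B₀ κ.kP κ.kC κ.kPD κ.kCD N N'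
    (fun y => g.len y) 𝔬.S 𝔬.S' 𝔬.h 𝔬.hY 𝔬.KP 𝔬.KC 𝔬.KPD 𝔬.KCD
    hB₀ hδ₀ hk12 hkD hN hN' hlen hαδ htri hs.refl hs.dnn hlen h261 h263 hsmall hs.hh hs.hhY hs.hSY hs.cnt hs.cnt'
    hs.KP_nonneg hs.KP_loc hs.KP_row hs.KC_nonneg hs.KC_loc hs.KC_row
    hs.KPD_nonneg hs.KPD_loc hs.KPD_row hs.KCD_nonneg hs.KCD_loc hs.KCD_row
    hl.e0 hl.e1 hl.e1 hi.hP hi.hC hi.hPD hi.hCD hi.leibD hi.inv hi.eq388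
  -- entry 3: G′∇*_U (`thm37_rightEntry_of_342`)
  have e3 := thm37_rightEntry_of_342 (R := R) (H := H) 𝔬.blk 𝔬.blkY d δ₀ α ρ B₀ κ.kPt κ.kCt κ.kCLt Cℓ N N'
    𝔬.S 𝔬.S' 𝔬.h 𝔬.hY 𝔬.KPt 𝔬.KCt 𝔬.KCLt
    hB₀ hδ₀ hκ.kPt hκ.kCt hκ.kCLt hCℓ0 hN hN' hαδ' hαδ2 htri hs.refl hs.symm hs.dnn hs.lenpos h261 h263 hsmall'
    hs.hh hs.hS hs.hhY hs.cnt hs.cnt' hs.comp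
    hs.KPt_nonneg hs.KPt_loc hs.KPt_col hs.KCt_nonneg hs.KCt_loc hs.KCt_col hs.KCLt_nonneg hs.KCLt_loc hs.KCLt_col
    hl.e0 hl.e2 hi.hPt hi.hCt hi.hCLt hi.leibT hi.inv hi.eq388T
  -- entry 4: Δ_UG′ (`thm37_leftEntry_of_342` at E = Δ_U, W ≡ 1)
  have e4 := thm37_leftEntry_of_342 (R := R) (H := H) 𝔬.blk 𝔬.blkY 𝔬.blk d δ₀ α ρ B₀ κ.kP κ.kC κ.kPL κ.kCL N N'
    (fun _ => (1 : ℝ)) 𝔬.S 𝔬.S' 𝔬.h 𝔬.h 𝔬.KP 𝔬.KC 𝔬.KPL 𝔬.KCL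
    hB₀ hδ₀ hk12 hkL hN hN' (fun _ => zero_le_one) hαδ htri hs.refl hs.dnn hlen h261 h263 hsmall hs.hh hs.hh hs.hS
    hs.cnt hs.cnt'
    hs.KP_nonneg hs.KP_loc hs.KP_row hs.KC_nonneg hs.KC_loc hs.KC_row
    hs.KPL_nonneg hs.KPL_loc (fun i a => by simpa only [mul_one] using hs.KPL_row i a)
    hs.KCL_nonneg hs.KCL_loc (fun i a => by simpa only [mul_one] using hs.KCL_row i a)
    hl.e0 hl.e1
    (fun i => hasMajorantHom_mono (g := toB6 g R H) 𝔬.blk 𝔬.blk (hl.e3 i) fun a b => by simp only [mul_one, le_refl])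
    hi.hP hi.hC hi.hPL hi.hCL hi.leibL hi.inv hi.eq388
  -- the comparisons of the four constants with A′ = B₀(N + N′e^{δ₀ρ}(C_ℓK))c₁
  have hA1 : 0 ≤ N * B₀ * B6.c1 d δ₀ α := mul_nonneg (mul_nonneg hN hB₀) hc1
  have hA1' : N * B₀ * B6.c1 d δ₀ α ≤ B₀ * (N + N' * Real.exp (δ₀ * ρ) * (Cℓ * K)) * B6.c1 d δ₀ α := by
    have h1 : N ≤ N + N' * Real.exp (δ₀ * ρ) * (Cℓ * K) :=
      le_add_of_nonneg_right (mul_nonneg hN'e (mul_nonneg hCℓ0 hK))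
    calc N * B₀ * B6.c1 d δ₀ α = N * (B₀ * B6.c1 d δ₀ α) := by ring
      _ ≤ (N + N' * Real.exp (δ₀ * ρ) * (Cℓ * K)) * (B₀ * B6.c1 d δ₀ α) :=
          mul_le_mul_of_nonneg_right h1 (mul_nonneg hB₀ hc1)
      _ = B₀ * (N + N' * Real.exp (δ₀ * ρ) * (Cℓ * K)) * B6.c1 d δ₀ α := by ring
  have hA2 : 0 ≤ B₀ * (N + N' * Real.exp (δ₀ * ρ) * (κ.kPD + κ.kCD)) * B6.c1 d δ₀ α :=
    mul_nonneg (mul_nonneg hB₀ (add_nonneg hN (mul_nonneg hN'e hkD))) hc1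
  have hA2' : B₀ * (N + N' * Real.exp (δ₀ * ρ) * (κ.kPD + κ.kCD)) * B6.c1 d δ₀ α ≤
      B₀ * (N + N' * Real.exp (δ₀ * ρ) * (Cℓ * K)) * B6.c1 d δ₀ α :=
    constA_le hB₀ hN'e hc1 (hKD.trans hKCℓ)
  have hA4 : 0 ≤ B₀ * (N + N' * Real.exp (δ₀ * ρ) * (κ.kPL + κ.kCL)) * B6.c1 d δ₀ α :=
    mul_nonneg (mul_nonneg hB₀ (add_nonneg hN (mul_nonneg hN'e hkL))) hc1
  have hA4' : B₀ * (N + N' * Real.exp (δ₀ * ρ) * (κ.kPL + κ.kCL)) * B6.c1 d δ₀ α ≤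
      B₀ * (N + N' * Real.exp (δ₀ * ρ) * (Cℓ * K)) * B6.c1 d δ₀ α :=
    constA_le hB₀ hN'e hc1 (hKL.trans hKCℓ)
  have hA3 : 0 ≤ B₀ * (N + N' * Real.exp (δ₀ * ρ) * Cℓ * κ.kCLt) * B6.c1 d δ₀ α :=
    mul_nonneg (mul_nonneg hB₀ (add_nonneg hN (mul_nonneg (mul_nonneg hN'e hCℓ0) hκ.kCLt))) hc1
  have hA3' : B₀ * (N + N' * Real.exp (δ₀ * ρ) * Cℓ * κ.kCLt) * B6.c1 d δ₀ α ≤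
      B₀ * (N + N' * Real.exp (δ₀ * ρ) * (Cℓ * K)) * B6.c1 d δ₀ α := by
    have h := constA_le (N := N) hB₀ hN'e hc1 (mul_le_mul_of_nonneg_left hKT hCℓ0)
    calc B₀ * (N + N' * Real.exp (δ₀ * ρ) * Cℓ * κ.kCLt) * B6.c1 d δ₀ α
        = B₀ * (N + N' * Real.exp (δ₀ * ρ) * (Cℓ * κ.kCLt)) * B6.c1 d δ₀ α := by ring
      _ ≤ B₀ * (N + N' * Real.exp (δ₀ * ρ) * (Cℓ * K)) * B6.c1 d δ₀ α := h
  refine ⟨?_, ?_, ?_, ?_⟩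
  · refine hasMajorant_mono (g := toB6 g R H) 𝔬.blk e1 fun a b => ?_
    calc N * B₀ * B6.c1 d δ₀ α * (1 - N' * (B₀ * Real.exp (δ₀ * ρ) * (κ.kP + κ.kC)) * B6.c1 d δ₀ α)⁻¹ *
          g.len a ^ 2 * Real.exp (-((1 - α) * δ₀ * g.dist a b))
        ≤ 2 * (B₀ * (N + N' * Real.exp (δ₀ * ρ) * (Cℓ * K)) * B6.c1 d δ₀ α) * g.len a ^ 2 *
            Real.exp (-((1 - 2 * α) * δ₀ * g.dist a b)) :=
          weaken hA1 hA1' hq (sq_nonneg _) (Real.exp_nonneg _) (hexp a b)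
      _ = _ := hfin _ _
  · refine hasMajorantHom_mono (g := toB6 g R H) 𝔬.blk 𝔬.blkY e2 fun a b => ?_
    calc B₀ * (N + N' * Real.exp (δ₀ * ρ) * (κ.kPD + κ.kCD)) * B6.c1 d δ₀ α *
          (1 - N' * (B₀ * Real.exp (δ₀ * ρ) * (κ.kP + κ.kC)) * B6.c1 d δ₀ α)⁻¹ * g.len a *
          Real.exp (-((1 - α) * δ₀ * g.dist a b))
        ≤ 2 * (B₀ * (N + N' * Real.exp (δ₀ * ρ) * (Cℓ * K)) * B6.c1 d δ₀ α) * g.len a *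
            Real.exp (-((1 - 2 * α) * δ₀ * g.dist a b)) :=
          weaken hA2 hA2' hq (hlen a) (Real.exp_nonneg _) (hexp a b)
      _ = _ := hfin _ _
  · refine hasMajorantHom_mono (g := toB6 g R H) 𝔬.blkY 𝔬.blk e3 fun a b => ?_
    calc B₀ * (N + N' * Real.exp (δ₀ * ρ) * Cℓ * κ.kCLt) * B6.c1 d δ₀ α *
          (1 - N' * (B₀ * Real.exp (δ₀ * ρ) * (κ.kPt + Cℓ * κ.kCt)) * B6.c1 d δ₀ α)⁻¹ * g.len a *
          Real.exp (-((1 - 2 * α) * δ₀ * g.dist a b))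
        ≤ 2 * (B₀ * (N + N' * Real.exp (δ₀ * ρ) * (Cℓ * K)) * B6.c1 d δ₀ α) * g.len a *
            Real.exp (-((1 - 2 * α) * δ₀ * g.dist a b)) :=
          weaken hA3 hA3' hq' (hlen a) (Real.exp_nonneg _) le_rfl
      _ = _ := hfin _ _
  · refine hasMajorantHom_mono (g := toB6 g R H) 𝔬.blk 𝔬.blk e4 fun a b => ?_
    calc B₀ * (N + N' * Real.exp (δ₀ * ρ) * (κ.kPL + κ.kCL)) * B6.c1 d δ₀ α *
          (1 - N' * (B₀ * Real.exp (δ₀ * ρ) * (κ.kP + κ.kC)) * B6.c1 d δ₀ α)⁻¹ * (fun _ => (1 : ℝ)) a *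
          Real.exp (-((1 - α) * δ₀ * g.dist a b))
        ≤ 2 * (B₀ * (N + N' * Real.exp (δ₀ * ρ) * (Cℓ * K)) * B6.c1 d δ₀ α) * (fun _ => (1 : ℝ)) a *
            Real.exp (-((1 - 2 * α) * δ₀ * g.dist a b)) :=
          weaken hA4 hA4' hq zero_le_one (Real.exp_nonneg _) (hexp a b)
      _ = const37 d δ₀ α ρ B₀ N N' Cℓ K * Real.exp (-((1 - 2 * α) * δ₀ * g.dist a b)) := by
          simp only [const37]
          ring

omit [Fintype g.Site] [DecidableEq g.Site] in
/-- Arithmetic of «for M sufficiently large»: a size s ≦ θ₀M⁻¹ and M ≧ 2N′B₀e^{δ₀ρ}θ₀c₁ give N′B₀e^{δ₀ρ}sc₁ ≦ ½.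
[folklore] -/
private theorem small_of_size {N' B₀ ex s θ₀ c M : ℝ} (hN' : 0 ≤ N') (hB : 0 ≤ B₀ * ex) (hc : 0 ≤ c) (hM : 0 < M)
    (hs : s ≤ θ₀ * M⁻¹) (hbig : 2 * N' * (B₀ * ex * θ₀) * c ≤ M) : N' * (B₀ * ex * s) * c ≤ 1 / 2 := by
  have h1 : N' * (B₀ * ex * s) * c ≤ N' * (B₀ * ex * (θ₀ * M⁻¹)) * c :=
    mul_le_mul_of_nonneg_right (mul_le_mul_of_nonneg_left (mul_le_mul_of_nonneg_left hs hB) hN') hc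
  have h2 : N' * (B₀ * ex * (θ₀ * M⁻¹)) * c = (N' * (B₀ * ex * θ₀) * c) / M := by
    rw [div_eq_mul_inv]
    ring
  have h3 : (N' * (B₀ * ex * θ₀) * c) / M ≤ 1 / 2 := by
    rw [div_le_iff₀ hM]
    linarith
  exact h1.trans (h2.le.trans h3)

end OneMember

section Family

variable {I : Type} {c35 : ℝ} {geo : I → B9.Geometry} {bg : I → B9.Backgrounds}
variable [∀ i, Fintype (geo i).Site] [∀ i, DecidableEq (geo i).Site]
variable {X Y ι : I → Type} [∀ i, Fintype (X i)] [∀ i, DecidableEq (X i)] [∀ i, Fintype (Y i)]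
  [∀ i, DecidableEq (Y i)] [∀ i, Fintype (ι i)]

/-- ★ **THEOREM 3.7 AS THE WHOLE PRINTED LEAF `B9.Thm37Printed`** (p. 409: *"For M sufficiently large, and a configuration U
satisfying (3.35), the operator G′ can be represented as … (3.90) … The expansion is convergent in all norms appearing in the
inequalities (3.42)–(3.47)."*), INHABITED at the expansion data `E37OfOps (𝔴 i) (𝔬 i) (R i) (H i) C δ` with the explicit
constants C = `const37 d δ₀ α ρ B₀ N N' Cℓ K`, δ = (1 − 2α)δ₀ — from, per member and per U under the printed provisos of
Corollary 3.6 (M ≧ M₁, 0 < α₀, O(1)Mα₀ ≦ a₁, U satisfying (3.35) = `Reg335 c35 α₀ U`): Corollary 3.6 for all G′_□(U)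
(`Local342`) and the structure of the expansion (`Identities`); per member: the static data (`StaticOK`), the kernel sizes
(`Sizes.Bounded`: the K(h_□) sizes ≦ θ₀M⁻¹ — the displayed O(M⁻¹) of (3.89) — the Leibniz sizes ≦ K), and [4] Lemma 2.1 (2.61)
at the exponent α for M ≧ M_L.  The printed quantifiers are met with M₂ := max(M₁, M_L, 2N′B₀e^{δ₀ρ}θ₀c₁(α)) and
a₀ := a₁ ∕ O(1) (O(1) = `c35`, the geometric factor of (3.35)).  p. 410: *"This theorem follows simply from Corollary 3.6
holding for all G′_□, □ ∈ 𝒟, from the bound (3.89) and Lemma 2.1. The arguments are exactly the same as in proofs of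
Proposition 1.2 [3] and Proposition 2.2 [4], so we will not repeat them here."*  Nothing of print asserted (all inputs are
hypotheses of printed shape); the sup block (3.42) only; NOT a node discharge.
[cite: Balaban1985BackgroundPropagators, Thm 3.7 (3.90) pp.409–410 + Cor. 3.6 p.408 + (3.35) p.396; Balaban1984PropagatorsII, Lemma 2.1 (2.61) p.234 + Prop 2.2 p.234] -/
theorem thm37Printed_of_local342 (𝔴 : ∀ i, B9.RWExpansion (geo i) (bg i))
    (𝔬 : ∀ i, Ops (geo i) (bg i) (X i) (Y i) (ι i)) (R : I → ℝ) (H : I → Prop) (κ : I → Sizes) (d : ℕ)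
    (α ρ N N' Cℓ K θ₀ B₀ δ₀ a₁ M₁ ML : ℝ)
    (hc : 0 < c35) (hα : 0 ≤ α) (hα2 : α ≤ 1 / 2) (hN : 0 ≤ N) (hN' : 0 ≤ N') (hCℓ : 1 ≤ Cℓ) (hK : 0 ≤ K)
    (hB₀ : 0 ≤ B₀) (hδ₀ : 0 ≤ δ₀) (ha₁ : 0 < a₁) (hM₁ : 0 < M₁)
    (hst : ∀ i, StaticOK (𝔬 i) ρ N N' Cℓ (κ i)) (hκ : ∀ i, (κ i).Bounded K θ₀ Cℓ (geo i).M)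
    (h261 : ∀ i, ML ≤ (geo i).M → Ineq261 d (toB6 (geo i) (R i) (H i)) δ₀ α)
    (h36 : ∀ i, M₁ ≤ (geo i).M → ∀ α₀ : ℝ, 0 < α₀ → c35 * (geo i).M * α₀ ≤ a₁ →
      ∀ U : (bg i).Cfg, (bg i).Reg335 c35 α₀ U →
        Local342 (𝔬 i) (R i) (H i) B₀ δ₀ U ∧ Identities (𝔬 i) (R i) (H i) U) :
    B9.Thm37Printed c35 geo bg
      (fun i => E37OfOps (𝔴 i) (𝔬 i) (R i) (H i) (const37 d δ₀ α ρ B₀ N N' Cℓ K) ((1 - 2 * α) * δ₀)) := by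
  refine ⟨max M₁ (max ML (2 * N' * (B₀ * Real.exp (δ₀ * ρ) * θ₀) * B6.c1 d δ₀ α)), a₁ / c35,
    lt_max_of_lt_left hM₁, div_pos ha₁ hc, ?_⟩
  intro i hM α₀ hα₀ hMa U hU
  have hM₁i : M₁ ≤ (geo i).M := le_trans (le_max_left _ _) hM
  have hMLi : ML ≤ (geo i).M := le_trans (le_trans (le_max_left _ _) (le_max_right _ _)) hM
  have hbig : 2 * N' * (B₀ * Real.exp (δ₀ * ρ) * θ₀) * B6.c1 d δ₀ α ≤ (geo i).M :=
    le_trans (le_trans (le_max_right _ _) (le_max_right _ _)) hM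
  have hMpos : 0 < (geo i).M := lt_of_lt_of_le hM₁ hM₁i
  have ha : c35 * (geo i).M * α₀ ≤ a₁ := by
    have h1 : (geo i).M * α₀ * c35 ≤ a₁ := (le_div_iff₀ hc).mp hMa
    calc c35 * (geo i).M * α₀ = (geo i).M * α₀ * c35 := by ring
      _ ≤ a₁ := h1
  obtain ⟨hl, hi⟩ := h36 i hM₁i α₀ hα₀ ha U hU
  have hBe : 0 ≤ B₀ * Real.exp (δ₀ * ρ) := mul_nonneg hB₀ (Real.exp_nonneg _)
  have hc1 : 0 ≤ B6.c1 d δ₀ α := c1_nonneg d δ₀ α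
  have hq : N' * (B₀ * Real.exp (δ₀ * ρ) * ((κ i).kP + (κ i).kC)) * B6.c1 d δ₀ α ≤ 1 / 2 :=
    small_of_size hN' hBe hc1 hMpos (hκ i).row hbig
  have hq' : N' * (B₀ * Real.exp (δ₀ * ρ) * ((κ i).kPt + Cℓ * (κ i).kCt)) * B6.c1 d δ₀ α ≤ 1 / 2 :=
    small_of_size hN' hBe hc1 hMpos (hκ i).col hbig
  exact conv342_of_local342 (𝔬 i) (R i) (H i) d δ₀ α ρ B₀ N N' Cℓ K (κ i) U hB₀ hδ₀ hα hα2 hN hN' hCℓ hK (hst i)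
    (hκ i).nonneg (hκ i).leibD (hκ i).leibL (hκ i).leibT (h261 i hMLi) hq hq' hl hi

/-! ## §4 The consumer face: the leaf at `E37OfOps` yields the (3.42) clauses of Theorem 3.1 -/

omit [∀ i, DecidableEq (geo i).Site] [∀ i, Fintype (X i)] [∀ i, DecidableEq (X i)] [∀ i, Fintype (Y i)]
  [∀ i, DecidableEq (Y i)] [∀ i, Fintype (ι i)] in
/-- **p. 410: «Theorem 3.7 implies that all the inequalities (3.42)–(3.47) hold for G′» — the (3.42) block, kernel-checked at
the pinned expansion data.**  If the four model operators G′(U), ∇_UG′(U), G′(U)∇*_U, Δ_UG′(U) of `𝔬 i` are CO-READ by the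
observation quantities e₀, …, e₃ of a kernel family `Gp i` (`B9Thm37GlueCor36.CoRealizes`: e_n is the printed sup over the
block, (3.39) ∕ (3.42) p. 397 — a reading hypothesis, nothing asserted), then the leaf `B9.Thm37Printed` AT
`E37OfOps … C δ` gives, under its own provisos (M ≧ M₂, 0 < α₀, Mα₀ ≦ a₀, (3.35)), the four clauses (3.42) AS TYPED for
`Gp i` with the constants (C, δ) (`B9Thm37GlueCor36.Clause342`; with (3.46), (3.47) displayed they assemble to
`B9.Ineq342_346_347` by `B9Thm37GlueCor36.ineq342_346_347_of_clauses`) — the (3.42) block of the summation leaf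
`B9.RWSumsYieldIneqs` ∕ of `B9.Thm31Printed`.  [cite: Balaban1985BackgroundPropagators, Thm 3.7 ⇒ Thm 3.1 p.410 + (3.42) p.397] -/
theorem clause342_of_thm37Printed {𝔴 : ∀ i, B9.RWExpansion (geo i) (bg i)}
    {𝔬 : ∀ i, Ops (geo i) (bg i) (X i) (Y i) (ι i)} {R : I → ℝ} {H : I → Prop} {C δ : ℝ}
    (Gp : ∀ i, B9.KernelFamily (geo i) (bg i)) (ev : ∀ i, (geo i).Loc → X i → ℝ)
    (evY : ∀ i, (geo i).Loc → Y i → ℝ)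
    (h37 : B9.Thm37Printed c35 geo bg (fun i => E37OfOps (𝔴 i) (𝔬 i) (R i) (H i) C δ))
    (hC : 0 ≤ C) (hlen : ∀ i (y : (geo i).Site), 0 ≤ (geo i).len y)
    (hco0 : ∀ i U, CoRealizes (Gp i) 0 U (𝔬 i).blk (𝔬 i).blk (ev i) ((𝔬 i).Gp U))
    (hco1 : ∀ i U, CoRealizes (Gp i) 1 U (𝔬 i).blkY (𝔬 i).blk (ev i) ((𝔬 i).D U ∘ₗ (𝔬 i).Gp U))
    (hco2 : ∀ i U, CoRealizes (Gp i) 2 U (𝔬 i).blk (𝔬 i).blkY (evY i) ((𝔬 i).Gp U ∘ₗ (𝔬 i).Dstar U))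
    (hco3 : ∀ i U, CoRealizes (Gp i) 3 U (𝔬 i).blk (𝔬 i).blk (ev i) ((𝔬 i).Lap U ∘ₗ (𝔬 i).Gp U)) :
    ∃ M₂ a₀ : ℝ, 0 < M₂ ∧ 0 < a₀ ∧
      ∀ i : I, M₂ ≤ (geo i).M → ∀ α₀ : ℝ, 0 < α₀ → (geo i).M * α₀ ≤ a₀ →
        ∀ U : (bg i).Cfg, (bg i).Reg335 c35 α₀ U → ∀ n : Fin 4, Clause342 (Gp i) n C δ U := by
  obtain ⟨M₂, a₀, hM₂, ha₀, h⟩ := h37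
  refine ⟨M₂, a₀, hM₂, ha₀, fun i hMi α₀ hα₀ hMa U hU => ?_⟩
  have hconv : Conv342 (𝔬 i) (R i) (H i) C δ U := h i hMi α₀ hα₀ hMa U hU
  obtain ⟨h0, h1, h2, h3⟩ := hconv
  exact clause342_all (clause342_e0_of_hasMajorant (hco0 i U) h0 hC (hlen i))
    (clause342_e1_of_hasMajorantHom (hco1 i U) h1 hC (hlen i))
    (clause342_e2_of_hasMajorantHom (hco2 i U) h2 hC (hlen i))
    (clause342_e3_of_hasMajorantHom (hco3 i U) h3 hC (hlen i))

end Family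

/-! ## §5 (v1.1) The leaf from the cell's TYPED Corollary 3.6 `B9.Cor36Printed`, by name

p. 409 (verbatim): *"Let us define Ω_n(□) = □̃ ∩ Ω_n, n = 0, 1, …, j, where j is the index of □ […] the sequence {Ω_n(□)}
satisfies the assumptions of Corollary 3.6. The operators constructed for this sequence, which we denote by G′_□(U), …,
satisfy all the inequalities of Theorems 3.1–3.3 correspondingly."*  The local sequences {Ω_n(□)}, □ ∈ 𝒟 of the member i,
are themselves members of the printed family (index (torus, k, {Ω_j}, M), p. 399: constants independent of {Ω_j}), read on
the member's geometry: below, the cell's typed Corollary 3.6 is taken over the Σ-family `(i, □)` with geometry `geo i`,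
and the four words G′_□(U), ∇_UG′_□(U), G′_□(U)∇*_U, Δ_UG′_□(U) of `Ops` are REALIZED (`B9SectCDiffDict.Realizes`, the
cell's reading hypothesis) by the observation quantities e₀, …, e₃ of that member's G′-family.  Then `Local342` follows
from `B9.Cor36Printed` (`B9Thm37GlueCor36.hasMajorant_e0_of_ineq342` &c.), and the leaf follows with the constants of
Corollary 3.6 — existentially, as print states them. -/

section FromCor36

variable {I : Type} {c35 : ℝ} {geo : I → B9.Geometry} {bg : I → B9.Backgrounds}
variable [∀ i, Fintype (geo i).Site] [∀ i, DecidableEq (geo i).Site]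
variable {X Y ι : I → Type} [∀ i, Fintype (X i)] [∀ i, DecidableEq (X i)] [∀ i, Fintype (Y i)]
  [∀ i, DecidableEq (Y i)] [∀ i, Fintype (ι i)]

omit [∀ i, Fintype (ι i)] in
/-- **«The operators G′_□(U) … satisfy all the inequalities of Theorems 3.1–3.3» (p. 409) ⇒ `Local342`, FROM THE TYPED
COROLLARY 3.6.**  With `B9.Cor36Printed` over the Σ-family of the local sequences {Ω_n(□)} (every □ ∈ 𝒟 of every member
lies in a cube of the class of (3.35): `hIn`) and the four words of G′_□(U) realized by e₀, …, e₃ of the local G′-family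
(`Realizes`, hypotheses `hR0 … hR3`), Corollary 3.6's constants a₁, M₁, B₀, δ₀ serve every member: for M ≧ M₁, 0 < α₀,
O(1)Mα₀ ≦ a₁ and U satisfying (3.35), `Local342 (𝔬 i) (R i) (H i) B₀ δ₀ U`.  Corollary 3.6 is NOT asserted (hypothesis
`h36`). [cite: Balaban1985BackgroundPropagators, Cor. 3.6 p.408 + p.409 + (3.42) p.397] -/
theorem local342_of_cor36Printed {d : ℕ} (𝔬 : ∀ i, Ops (geo i) (bg i) (X i) (Y i) (ι i)) (R : I → ℝ)
    (H : I → Prop) {InCube : (Σ i, ι i) → Prop} {GpL GAL : ∀ p : (Σ i, ι i), B9.KernelFamily (geo p.1) (bg p.1)}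
    {CinvL : ∀ p : (Σ i, ι i), B9.SiteKernel (geo p.1) (bg p.1)}
    (h36 : B9.Cor36Printed d c35 (fun p : (Σ i, ι i) => geo p.1) (fun p => bg p.1) InCube GpL GAL CinvL)
    (hIn : ∀ i (q : ι i), InCube ⟨i, q⟩) (hlen : ∀ i (y : (geo i).Site), 0 ≤ (geo i).len y)
    (hR0 : ∀ i (q : ι i) (U : (bg i).Cfg),
      B9SectCDiffDict.Realizes (GpL ⟨i, q⟩) 0 U (𝔬 i).blk (𝔬 i).blk (LinearMap.toMatrix' ((𝔬 i).Gsq U q)))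
    (hR1 : ∀ i (q : ι i) (U : (bg i).Cfg),
      B9SectCDiffDict.Realizes (GpL ⟨i, q⟩) 1 U (𝔬 i).blkY (𝔬 i).blk (LinearMap.toMatrix' ((𝔬 i).D U ∘ₗ (𝔬 i).Gsq U q)))
    (hR2 : ∀ i (q : ι i) (U : (bg i).Cfg),
      B9SectCDiffDict.Realizes (GpL ⟨i, q⟩) 2 U (𝔬 i).blk (𝔬 i).blkY (LinearMap.toMatrix' ((𝔬 i).Gsq U q ∘ₗ (𝔬 i).Dstar U)))
    (hR3 : ∀ i (q : ι i) (U : (bg i).Cfg),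
      B9SectCDiffDict.Realizes (GpL ⟨i, q⟩) 3 U (𝔬 i).blk (𝔬 i).blk (LinearMap.toMatrix' ((𝔬 i).Lap U ∘ₗ (𝔬 i).Gsq U q))) :
    ∃ a₁ M₁ B₀ δ₀ : ℝ, 0 < a₁ ∧ 0 < M₁ ∧ 0 < B₀ ∧ 0 < δ₀ ∧
      ∀ i : I, M₁ ≤ (geo i).M → ∀ α₀ : ℝ, 0 < α₀ → c35 * (geo i).M * α₀ ≤ a₁ →
        ∀ U : (bg i).Cfg, (bg i).Reg335 c35 α₀ U → Local342 (𝔬 i) (R i) (H i) B₀ δ₀ U := by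
  obtain ⟨a₁, M₁, B₀, δ₀, Bβ, Bε, Bεβ, B₁, δ₁, ha₁, hM₁, hB₀, hδ₀, -, -, hall⟩ := h36
  refine ⟨a₁, M₁, B₀, δ₀, ha₁, hM₁, hB₀, hδ₀, fun i hM α₀ hα₀ ha U hU => ?_⟩
  have hI : ∀ q : ι i, B9.Ineq342_346_347 (GpL ⟨i, q⟩) B₀ δ₀ U := fun q =>
    (hall ⟨i, q⟩ (hIn i q) hM α₀ hα₀ ha U hU).1.1
  exact ⟨fun q => hasMajorant_e0_of_ineq342 (hI q) (hR0 i q U) hB₀.le (hlen i),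
    fun q => hasMajorantHom_e1_of_ineq342 (hI q) (hR1 i q U) hB₀.le (hlen i),
    fun q => hasMajorantHom_e2_of_ineq342 (hI q) (hR2 i q U) hB₀.le (hlen i),
    fun q => hasMajorantHom_e3_of_ineq342 (hI q) (hR3 i q U) hB₀.le (hlen i)⟩

/-- ★ **THEOREM 3.7 AS THE WHOLE PRINTED LEAF, FROM THE CELL'S TYPED COROLLARY 3.6 BY NAME** — p. 410: *"This theorem
follows simply from Corollary 3.6 holding for all G′_□, □ ∈ 𝒟, from the bound (3.89) and Lemma 2.1."*: `B9.Cor36Printed`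
over the Σ-family of the local sequences (with the `Realizes` readings of the four words of G′_□(U)), the structure of the
expansion at the regular configurations (`Identities`), the static data and kernel sizes (`StaticOK`, `Sizes.Bounded` — the
bound (3.89) with its O(M⁻¹)), and [4] Lemma 2.1 (2.61) in its printed «RM sufficiently large» form at the exponent α
(for every rate δ₀ > 0 an M-threshold) give the leaf `B9.Thm37Printed c35 geo bg (fun i => E37OfOps … C δ)` for SOME
constants C ≧ 0, δ > 0 (C = `const37 …` and δ = (1 − 2α)δ₀ at Corollary 3.6's B₀, δ₀ — existential, as print's
*"There exist positive constants … dependent on d and L only"*).  Nothing of print asserted; NOT a node discharge.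
[cite: Balaban1985BackgroundPropagators, Thm 3.7 pp.409–410 + Cor. 3.6 p.408; Balaban1984PropagatorsII, Lemma 2.1 (2.59)–(2.61) pp.233–234] -/
theorem thm37Printed_of_cor36Printed {d : ℕ} (𝔴 : ∀ i, B9.RWExpansion (geo i) (bg i))
    (𝔬 : ∀ i, Ops (geo i) (bg i) (X i) (Y i) (ι i)) (R : I → ℝ) (H : I → Prop) (κ : I → Sizes)
    (α ρ N N' Cℓ K θ₀ : ℝ) {InCube : (Σ i, ι i) → Prop}
    {GpL GAL : ∀ p : (Σ i, ι i), B9.KernelFamily (geo p.1) (bg p.1)}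
    {CinvL : ∀ p : (Σ i, ι i), B9.SiteKernel (geo p.1) (bg p.1)}
    (hc : 0 < c35) (hα : 0 ≤ α) (hα2 : α < 1 / 2) (hN : 0 ≤ N) (hN' : 0 ≤ N') (hCℓ : 1 ≤ Cℓ) (hK : 0 ≤ K)
    (hst : ∀ i, StaticOK (𝔬 i) ρ N N' Cℓ (κ i)) (hκ : ∀ i, (κ i).Bounded K θ₀ Cℓ (geo i).M)
    (hL21 : ∀ δ₀ : ℝ, 0 < δ₀ → ∃ ML : ℝ, ∀ i, ML ≤ (geo i).M → Ineq261 d (toB6 (geo i) (R i) (H i)) δ₀ α)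
    (h36 : B9.Cor36Printed d c35 (fun p : (Σ i, ι i) => geo p.1) (fun p => bg p.1) InCube GpL GAL CinvL)
    (hIn : ∀ i (q : ι i), InCube ⟨i, q⟩)
    (hR0 : ∀ i (q : ι i) (U : (bg i).Cfg),
      B9SectCDiffDict.Realizes (GpL ⟨i, q⟩) 0 U (𝔬 i).blk (𝔬 i).blk (LinearMap.toMatrix' ((𝔬 i).Gsq U q)))
    (hR1 : ∀ i (q : ι i) (U : (bg i).Cfg),
      B9SectCDiffDict.Realizes (GpL ⟨i, q⟩) 1 U (𝔬 i).blkY (𝔬 i).blk (LinearMap.toMatrix' ((𝔬 i).D U ∘ₗ (𝔬 i).Gsq U q)))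
    (hR2 : ∀ i (q : ι i) (U : (bg i).Cfg),
      B9SectCDiffDict.Realizes (GpL ⟨i, q⟩) 2 U (𝔬 i).blk (𝔬 i).blkY (LinearMap.toMatrix' ((𝔬 i).Gsq U q ∘ₗ (𝔬 i).Dstar U)))
    (hR3 : ∀ i (q : ι i) (U : (bg i).Cfg),
      B9SectCDiffDict.Realizes (GpL ⟨i, q⟩) 3 U (𝔬 i).blk (𝔬 i).blk (LinearMap.toMatrix' ((𝔬 i).Lap U ∘ₗ (𝔬 i).Gsq U q)))
    (hid : ∀ i (α₀ : ℝ) (U : (bg i).Cfg), 0 < α₀ → (bg i).Reg335 c35 α₀ U → Identities (𝔬 i) (R i) (H i) U) :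
    ∃ C δ : ℝ, 0 ≤ C ∧ 0 < δ ∧
      B9.Thm37Printed c35 geo bg (fun i => E37OfOps (𝔴 i) (𝔬 i) (R i) (H i) C δ) := by
  have hlen : ∀ i (y : (geo i).Site), 0 ≤ (geo i).len y := fun i y => ((hst i).lenpos y).le
  obtain ⟨a₁, M₁, B₀, δ₀, ha₁, hM₁, hB₀, hδ₀, hloc⟩ :=
    local342_of_cor36Printed 𝔬 R H h36 hIn hlen hR0 hR1 hR2 hR3
  obtain ⟨ML, h261⟩ := hL21 δ₀ hδ₀
  have hCℓ0 : 0 ≤ Cℓ := le_trans zero_le_one hCℓ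
  refine ⟨const37 d δ₀ α ρ B₀ N N' Cℓ K, (1 - 2 * α) * δ₀, ?_, mul_pos (by linarith) hδ₀, ?_⟩
  · simp only [const37]
    exact mul_nonneg (mul_nonneg (mul_nonneg (by norm_num) hB₀.le)
      (add_nonneg hN (mul_nonneg (mul_nonneg (mul_nonneg hN' (Real.exp_nonneg _)) hCℓ0) hK))) (c1_nonneg d δ₀ α)
  · exact thm37Printed_of_local342 𝔴 𝔬 R H κ d α ρ N N' Cℓ K θ₀ B₀ δ₀ a₁ M₁ ML hc hα hα2.le hN hN' hCℓ hK hB₀.le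
      hδ₀.le ha₁ hM₁ hst hκ h261
      (fun i hM α₀ hα₀ ha U hU => ⟨hloc i hM α₀ hα₀ ha U hU, hid i α₀ U hα₀ hU⟩)

end FromCor36

section Cor38

variable {I : Type} {c35 : ℝ} {geo : I → B9.Geometry} {bg : I → B9.Backgrounds}
variable [∀ i, Fintype (geo i).Site] {X Y ι : I → Type}

/-- **Corollary 3.8 at the pinned expansion data is Corollary 3.8 at the given data** (by `Iff.rfl`): `E37OfOps` changes
only the convergence predicate, so the leaf `B9.Cor38Printed` (the U-localisation clause and the bound (3.94) on the
terms of (3.90), p. 410) read at `E37OfOps (𝔴 i) …` IS the same leaf read at `𝔴` — the knit's `c38` is untouched by the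
pin of `t37`. [cite: Balaban1985BackgroundPropagators, Cor. 3.8 (3.93)–(3.94) p.410] -/
theorem cor38Printed_E37OfOps_iff (𝔴 : ∀ i, B9.RWExpansion (geo i) (bg i))
    (𝔬 : ∀ i, Ops (geo i) (bg i) (X i) (Y i) (ι i)) (R : I → ℝ) (H : I → Prop) (C δ : ℝ) :
    B9.Cor38Printed c35 geo bg (fun i => E37OfOps (𝔴 i) (𝔬 i) (R i) (H i) C δ) ↔ B9.Cor38Printed c35 geo bg 𝔴 :=
  Iff.rfl

end Cor38

end

end Literature.MathematicalPhysics.QuantumFieldTheory.Balaban1983to89.B9Thm37Whole
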